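import Literature.AlgebraicGeometry.ShimuraVarieties.UnitaryShimuraCurveHomRigidityOfSpecialFibres
import Literature.AlgebraicGeometry.AbelianSchemes.PolarizationTypeLocallyConstant
import Literature.AlgebraicGeometry.AbelianSchemes.PolarizationTypeLocus
import Literature.AlgebraicGeometry.Morphisms.LocallyNoetherianLocallyConnected
import HarnessLib

/-!
# The TYPE of a polarisation over the thickened unitary Shimura curve `X = (M_K) ⊗_L Fᵢ` is read off the special complex fibres
# ([MumfordFogartyKirwan1994] App. 7A «`𝒜_{g,d,n} = ∐_δ 𝒜_{g,δ,n}` open and closed»; [Deligne1979ShimuraVarieties] 2.1.2–2.1.3)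

Topic `AlgebraicGeometry/ShimuraVarieties`; namespace `Literature.AlgebraicGeometry.ShimuraVarieties.UnitaryCanonicalModel.RecordSystemGS` (§1 is a
dot-notation extension of ★ `AbelianSchemeOver.Polarization`, declared with its absolute name).  THEOREMS ONLY (no definition, no named fact, no
instance, no notation, no `sorry`).  Sequel of ★ `UnitaryShimuraCurveHomRigidityOfSpecialFibres` (one special complex point per connected component of
`X`, §2 there) and ★ `PolarizationTypeLocallyConstant` (constancy of the type on a connected base).  Cell `hodgecm-mathlib` (D-0151), FLOOR 0, P6 «MOD»
(crux hLiu418 = stmt-HodgeConjecture-24832, `--supports`): the PER-COMPONENT GLUE of organ (N3) «`HasType δ` of the twisted polarisation by the MARKING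
road» of the (γ′) road for the E-sheet socket `hole_SHEET_complex` (LA4-plan (g2) BOOK v3, 2026-09-02): (N3) produces the `δ`-clause at ONE admissibly
marked complex fibre; this file turns «the clause at one special fibre per component» into `HasType δ` over all of `X` (the `hT` binder of ★
`SerreTwistModuliTupleRowA.exists_serreTwist_moduliTuple_of_isCMField_rowA`).  HC_CM is proved only modulo the printed citations (2 remaining named
inputs hLiu418 24832, h413 24833) until rung 0 closes; this file is generic in the polarised abelian scheme and changes no count.

THE MATHEMATICS.  The type of a polarisation `λ` of an abelian scheme over a locally Noetherian base `S` of residue characteristics prime to every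
positive integer is locally constant ([MumfordFogartyKirwan1994] App. 7A): on each connected component — an OPEN subscheme, `S` being locally
connected — it is determined by the `δ`-clause `K(λ̄_{s̄₀}) ≅ (∏ᵢ ℤ∕δᵢ)²` at one geometric point (★ `hasType_of_exists_mulHom_at`).  Hence one such point per
connected component gives `HasType δ` (§1).  Over `X = (M_K) ⊗_L Fᵢ` every connected component receives a special complex point (★
`exists_specialPoint_base_mem_connectedComponent`), so the clause at the special complex fibres — in honest-point or in sheet currency `ℓ_{τE}(z₀)` —
gives the type over `X` (§2).

* §1 `AbelianSchemeOver.Polarization.hasType_of_forall_exists_mulHom` (+ `_of_charZero`).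
* §2 **`hasType_of_forall_specialPoint`**, **`hasType_of_forall_specialPoint_sheet`** — THE HEADS over `X`.

## References
* [MumfordFogartyKirwan1994] D. Mumford, J. Fogarty, F. Kirwan, *Geometric Invariant Theory*, 3rd ed. (1994), App. 7A (pp. 234–235).
* [Deligne1979ShimuraVarieties] P. Deligne, *Variétés de Shimura* (1979), 2.1.2–2.1.3.
-/

set_option autoImplicit false

noncomputable section

universe u

open Matrix NumberField CategoryTheory CategoryTheory.Limits AlgebraicGeometry Topology
open scoped MonObj
open Literature.NumberTheory.Automorphic.Liu2021.AppendixC (C5.OpenCompactSubgroup C5.SmallLevel)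
open Literature.NumberTheory.Automorphic.UnitaryGroup (finAdelic)
open Literature.AlgebraicGeometry.Motives (ComplexPoints AlgPoints SchemeOver baseChange)
open Literature.AlgebraicGeometry.Motives.AbelianVariety (bcSpec)
open Literature.AlgebraicGeometry.AbelianSchemes (AbelianSchemeOver)
open Literature.AlgebraicGeometry.ModuliOfAbelianVarieties (IsPolarizationType)

namespace Literature.AlgebraicGeometry.ShimuraVarieties.UnitaryCanonicalModel

variable {L : Type} [Field L] [NumberField L] [IsCMField L] {Jstar : Matrix (Fin 2) (Fin 2) L} {τ : L →+* ℂ}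
  {K₀ : C5.OpenCompactSubgroup ↥(finAdelic (↥(maximalRealSubfield L)) L (IsCMField.complexConj L) 2 Jstar)}

namespace RecordSystemGS

/-! ### §1 Generic: the type from one geometric point with the `δ`-clause per connected component -/

/-- A geometric point whose image lies in an open `U ⊆ S` factors through `U` (twin of ★ `PolarizedLevelTypeLiftableLocus` §0). [folklore] -/
private theorem exists_lift_of_mem_opens {S : Scheme.{u}} (U : S.Opens) {Ω : Type u} [Field Ω] (s : Spec (.of Ω) ⟶ S)
    (hs : s.base (IsLocalRing.closedPoint Ω) ∈ U) : ∃ s' : Spec (.of Ω) ⟶ (U : Scheme.{u}), s' ≫ U.ι = s := by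
  have hr : Set.range s.base ⊆ Set.range U.ι.base := by
    rintro _ ⟨p, rfl⟩
    rw [Scheme.Opens.range_ι, Subsingleton.elim p (IsLocalRing.closedPoint Ω)]
    exact hs
  exact ⟨IsOpenImmersion.lift U.ι s hr, IsOpenImmersion.lift_fac U.ι s hr⟩

/-- Over a field of characteristic zero every positive integer is invertible in every residue field. [folklore] -/
private theorem natCast_residueField_ne_zero_of_charZero {S : Scheme.{u}} {K : Type u} [Field K] [CharZero K]
    (f : S ⟶ Spec (.of K)) (s : S) {m : ℕ} (hm : 0 < m) : (m : S.residueField s) ≠ 0 := by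
  let φ : K →+* S.residueField s := (Spec.preimage (S.fromSpecResidueField s ≫ f)).hom
  rw [← map_natCast φ m]
  exact (map_ne_zero φ).mpr (Nat.cast_ne_zero.mpr hm.ne')

/-- **The type of a polarisation from ONE geometric point with the `δ`-clause PER CONNECTED COMPONENT** (dot-notation extension of ★
`AbelianSchemeOver.Polarization`, absolute name): over a locally Noetherian `S` with every positive integer invertible in its residue fields, if
every `x ∈ S` has a geometric point `s₀` (algebraically closed field) centred in its connected component with `K(λ̄_{s₀}) ≅ (∏ᵢ ℤ∕δᵢ)²` (the
`δ`-clause), then `λ` has type `δ` — the component of `x` is an OPEN subscheme (★ `locallyConnectedSpace_of_isLocallyNoetherian`), `λ` over it has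
type `δ` by ★ `hasType_of_exists_mulHom_at`, and the clause descends at every geometric point over `x` (★ `exists_mulHom_baseChange_iff`); the
B-α-shaped twin of ★ `Polarization.typeAt_of_exists_mulHom`. [cite: MumfordFogartyKirwan1994, App. 7A (pp. 234–235)] -/
theorem _root_.Literature.AlgebraicGeometry.AbelianSchemes.AbelianSchemeOver.Polarization.hasType_of_forall_exists_mulHom
    {S : Scheme.{u}} [IsLocallyNoetherian S] {A : AbelianSchemeOver S} {D : A.DualPair} (pol : A.Polarization D)
    (hchar : ∀ (s : S) (m : ℕ), 0 < m → (m : S.residueField s) ≠ 0) {g₀ : ℕ} {δ : Fin g₀ → ℕ} (hδ : IsPolarizationType δ)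
    (h : ∀ x : S, ∃ (Ω₀ : Type u) (_ : Field Ω₀) (_ : IsAlgClosed Ω₀) (s₀ : Spec (.of Ω₀) ⟶ S),
      s₀.base (IsLocalRing.closedPoint Ω₀) ∈ connectedComponent x ∧
        ∃ ψ : Multiplicative (((i : Fin g₀) → ZMod (δ i)) × ((i : Fin g₀) → ZMod (δ i))) →*
          (A.fibre s₀).toAbelianVariety.Points Ω₀, Function.Injective ψ ∧ Set.range ψ = pol.kerPointsAt s₀) :
    pol.HasType δ := by
  refine ⟨hδ, fun Ω _ _ s => ?_⟩
  obtain ⟨x, hx⟩ : ∃ x : S, s.base (IsLocalRing.closedPoint Ω) = x := ⟨_, rfl⟩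
  obtain ⟨Ω₀, _, _, s₀, hs₀, h₀⟩ := h x
  haveI := Morphisms.locallyConnectedSpace_of_isLocallyNoetherian S
  let U : S.Opens := ⟨connectedComponent x, isOpen_connectedComponent⟩
  haveI : PreconnectedSpace (U : Scheme.{u}) := Subtype.preconnectedSpace (isPreconnected_connectedComponent (x := x))
  have hcharU : ∀ (u : (U : Scheme.{u})) (m : ℕ), 0 < m → (m : (U : Scheme.{u}).residueField u) ≠ 0 := by
    intro u m hm
    have h' := (map_ne_zero (U.ι.residueFieldMap u).hom).mpr (hchar (U.ι.base u) m hm)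
    rwa [map_natCast] at h'
  -- the clause at the lifted point `s₀′` of `U`, the type of `λ ×_S U`, and back down at `s`
  obtain ⟨s₀', rfl⟩ := exists_lift_of_mem_opens U s₀ hs₀
  have hT : (pol.baseChange U.ι).HasType δ :=
    (pol.baseChange U.ι).hasType_of_exists_mulHom_at hcharU hδ s₀' ((pol.exists_mulHom_baseChange_iff U.ι δ s₀').2 h₀)
  obtain ⟨s', rfl⟩ := exists_lift_of_mem_opens U s (by rw [hx]; exact mem_connectedComponent)
  exact (pol.exists_mulHom_baseChange_iff U.ι δ s').1 (hT.2 Ω s')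

/-- **The same over a field of characteristic zero** (`S → Spec K`, `CharZero K` — e.g. any `ℚ`-scheme): one geometric point with the
`δ`-clause per connected component gives `HasType δ`. [cite: MumfordFogartyKirwan1994, App. 7A (pp. 234–235)] -/
theorem _root_.Literature.AlgebraicGeometry.AbelianSchemes.AbelianSchemeOver.Polarization.hasType_of_forall_exists_mulHom_of_charZero
    {S : Scheme.{u}} [IsLocallyNoetherian S] {K : Type u} [Field K] [CharZero K] (f : S ⟶ Spec (.of K))
    {A : AbelianSchemeOver S} {D : A.DualPair} (pol : A.Polarization D) {g₀ : ℕ} {δ : Fin g₀ → ℕ} (hδ : IsPolarizationType δ)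
    (h : ∀ x : S, ∃ (Ω₀ : Type u) (_ : Field Ω₀) (_ : IsAlgClosed Ω₀) (s₀ : Spec (.of Ω₀) ⟶ S),
      s₀.base (IsLocalRing.closedPoint Ω₀) ∈ connectedComponent x ∧
        ∃ ψ : Multiplicative (((i : Fin g₀) → ZMod (δ i)) × ((i : Fin g₀) → ZMod (δ i))) →*
          (A.fibre s₀).toAbelianVariety.Points Ω₀, Function.Injective ψ ∧ Set.range ψ = pol.kerPointsAt s₀) :
    pol.HasType δ :=
  pol.hasType_of_forall_exists_mulHom (fun s _ hm => natCast_residueField_ne_zero_of_charZero f s hm) hδ h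

/-! ### §2 The heads over `X = (M_K) ⊗_L Fᵢ`: the type from the special complex fibres -/

set_option maxHeartbeats 400000 in
/-- **(N3), PER-COMPONENT GLUE — the TYPE of a polarisation over `X := (M_K) ⊗_L Fᵢ` is read off the special complex fibres**: for a polarisation
`λ` of an abelian scheme `A` over `X`, if at every honest complex point `P` of `X_ℂ` lying flat over a special point `[τw, aK]` of `M_K` the `δ`-clause
holds at the `X`-point `P ≫ pr` (`K(λ̄) ≅ (∏ᵢ ℤ∕δᵢ)²` — produced at a MARKED complex fibre by organ (N3)), then `λ` has type `δ` (`X` smooth over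
`Fᵢ ⊇ L ⊇ ℚ`: locally Noetherian, residue characteristic `0`; one special point per component by §2).
[cite: MumfordFogartyKirwan1994, App. 7A (pp. 234–235)] [cite: Deligne1979ShimuraVarieties, 2.1.2–2.1.3] -/
theorem hasType_of_forall_specialPoint (S : RecordSystemGS L Jstar τ K₀) (K : C5.SmallLevel K₀)
    {Fi : Type} [Field Fi] [Algebra L Fi] (τE : Fi →+* ℂ) (hτE : τE.comp (algebraMap L Fi) = τ)
    {A : AbelianSchemeOver ((baseChange L Fi).obj (S.M.obj K)).left} {D : A.DualPair} (pol : A.Polarization D)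
    {g₀ : ℕ} {δ : Fin g₀ → ℕ} (hδ : IsPolarizationType δ)
    (h : letI : Algebra Fi ℂ := τE.toAlgebra
      letI : Algebra L ℂ := τ.toAlgebra
      ∀ (w : Fin 2 → L) (hw : (fun i => τ (w i)) ∈ negCone (Jstar.map τ))
        (a : ↥(finAdelic (↥(maximalRealSubfield L)) L (IsCMField.complexConj L) 2 Jstar))
        (P : ComplexPoints ((baseChange Fi ℂ).obj ((baseChange L Fi).obj (S.M.obj K)))),
        P.left ≫ pullback.fst ((baseChange L Fi).obj (S.M.obj K)).hom (bcSpec Fi ℂ) ≫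
            pullback.fst (S.M.obj K).hom (bcSpec L Fi) =
          ((S.pts K).symm (ShimuraSetGS.mk L Jstar τ K.1.1 (fun i => τ (w i)) hw a)).left →
        ∃ ψ : Multiplicative (((i : Fin g₀) → ZMod (δ i)) × ((i : Fin g₀) → ZMod (δ i))) →*
          (A.fibre (P.left ≫ pullback.fst ((baseChange L Fi).obj (S.M.obj K)).hom (bcSpec Fi ℂ))).toAbelianVariety.Points ℂ,
          Function.Injective ψ ∧
            Set.range ψ = pol.kerPointsAt (P.left ≫ pullback.fst ((baseChange L Fi).obj (S.M.obj K)).hom (bcSpec Fi ℂ))) :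
    pol.HasType δ := by
  letI : Algebra Fi ℂ := τE.toAlgebra
  letI : Algebra L ℂ := τ.toAlgebra
  -- `X` is locally Noetherian (smooth over the field `Fᵢ`) of residue characteristic `0`
  haveI := S.smooth K
  haveI : Smooth (S.M.obj K).hom := SmoothOfRelativeDimension.smooth 1 _
  haveI : Smooth ((baseChange L Fi).obj (S.M.obj K)).hom := by
    change Smooth (pullback.snd (S.M.obj K).hom _)
    infer_instance
  haveI : IsLocallyNoetherian ((baseChange L Fi).obj (S.M.obj K)).left :=
    LocallyOfFiniteType.isLocallyNoetherian ((baseChange L Fi).obj (S.M.obj K)).hom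
  haveI : CharZero Fi := charZero_of_injective_algebraMap (algebraMap L Fi).injective
  refine pol.hasType_of_forall_exists_mulHom_of_charZero ((baseChange L Fi).obj (S.M.obj K)).hom hδ fun x => ?_
  obtain ⟨w, hw, a, P, hP, hflat⟩ := S.exists_specialPoint_base_mem_connectedComponent K τE hτE x
  exact ⟨ℂ, inferInstance, inferInstance, P.left ≫ pullback.fst ((baseChange L Fi).obj (S.M.obj K)).hom (bcSpec Fi ℂ), hP,
    h w hw a P hflat⟩

set_option maxHeartbeats 400000 in
/-- **(N3), PER-COMPONENT GLUE IN SHEET CURRENCY — the type over `X` from the `δ`-clause at the sheet points `ℓ_{τE}(z₀)` of the special points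
`z₀ = (S.pts K)⁻¹ [τw, aK]`** (the currency of the E-sheet socket; `eE` is the chart sheet `τE` as an `L`-algebra map). [cite: MumfordFogartyKirwan1994, App. 7A (pp. 234–235)] [cite: Deligne1979ShimuraVarieties, 2.1.2–2.1.3] -/
theorem hasType_of_forall_specialPoint_sheet (S : RecordSystemGS L Jstar τ K₀) (K : C5.SmallLevel K₀)
    {Fi : Type} [Field Fi] [Algebra L Fi] (τE : Fi →+* ℂ) (hτE : τE.comp (algebraMap L Fi) = τ)
    (eE : letI : Algebra L ℂ := τ.toAlgebra; Fi →ₐ[L] ℂ) (heE : ∀ x, eE x = τE x)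
    {A : AbelianSchemeOver ((baseChange L Fi).obj (S.M.obj K)).left} {D : A.DualPair} (pol : A.Polarization D)
    {g₀ : ℕ} {δ : Fin g₀ → ℕ} (hδ : IsPolarizationType δ)
    (h : letI : Algebra L ℂ := τ.toAlgebra
      ∀ (w : Fin 2 → L) (hw : (fun i => τ (w i)) ∈ negCone (Jstar.map τ))
        (a : ↥(finAdelic (↥(maximalRealSubfield L)) L (IsCMField.complexConj L) 2 Jstar)),
        ∃ ψ : Multiplicative (((i : Fin g₀) → ZMod (δ i)) × ((i : Fin g₀) → ZMod (δ i))) →*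
          (A.fibre (Motives.thickeningLift eE (S.M.obj K)
            ((S.pts K).symm (ShimuraSetGS.mk L Jstar τ K.1.1 (fun i => τ (w i)) hw a))).left).toAbelianVariety.Points ℂ,
          Function.Injective ψ ∧
            Set.range ψ = pol.kerPointsAt (Motives.thickeningLift eE (S.M.obj K)
              ((S.pts K).symm (ShimuraSetGS.mk L Jstar τ K.1.1 (fun i => τ (w i)) hw a))).left) :
    pol.HasType δ := by
  letI : Algebra Fi ℂ := τE.toAlgebra
  letI : Algebra L ℂ := τ.toAlgebra
  refine S.hasType_of_forall_specialPoint K τE hτE pol hδ fun w hw a P hflat => ?_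
  -- transport the clause along `P ≫ pr = ℓ_{eE}(z₀)` (dependent types: substitute a point variable)
  have key : ∀ {s s' : Spec (.of ℂ) ⟶ ((baseChange L Fi).obj (S.M.obj K)).left}, s = s' →
      (∃ ψ : Multiplicative (((i : Fin g₀) → ZMod (δ i)) × ((i : Fin g₀) → ZMod (δ i))) →*
          (A.fibre s').toAbelianVariety.Points ℂ, Function.Injective ψ ∧ Set.range ψ = pol.kerPointsAt s') →
        ∃ ψ : Multiplicative (((i : Fin g₀) → ZMod (δ i)) × ((i : Fin g₀) → ZMod (δ i))) →*
          (A.fibre s).toAbelianVariety.Points ℂ, Function.Injective ψ ∧ Set.range ψ = pol.kerPointsAt s := by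
    rintro s s' rfl h'
    exact h'
  exact key (S.left_comp_fst_eq_thickeningLift_left K τE eE heE P _ hflat) (h w hw a)

end RecordSystemGS

end Literature.AlgebraicGeometry.ShimuraVarieties.UnitaryCanonicalModel

end
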